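import Summits.QuantumFields.YangMills.Theorems.FemtoCutoffLadderFixedLatticeLawInnerRateCopies
import Summits.QuantumFields.YangMills.Theorems.FemtoTransferGapLevelsPos
import Summits.QuantumFields.YangMills.Theorems.LuscherReductionDressedRitzVacuumDictionary
import Summits.QuantumFields.YangMills.Theorems.TwistedTraceScaling.Negative.InnerValleyTargetsGuards
import HarnessLib

/-!
# Preliminaries for the Born–Oppenheimer ∕ Feshbach–Schur door with rate of `stub_innerRate` (crux `FixedLatticeLaw` stmt-QuantumFields-23943 ≡ leaf
# `FemtoGapFixedLattice`, route `FemtoCutoffLadder`, line «rate»): bounded-measurable bookkeeping, the exact max–min half of Courant–Fischer in family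
# form, and the completed-square endgame in real numbers

Lead seat `ym-line-fcl-p1` g4 (2026-08-28).  Used by `…FixedLatticeLawInnerRateBO` (next file), kept apart to respect the file-size limit:
* §1 bounded-measurable bookkeeping for a split `ψ = φ + χ` (the inner families of RED's one-orbit text `InnerNoIntruderOneOrbitAt` are gauge-invariant but NOT
  physical, so the tree's `IsPhys`-typed bilinearity lemmas do not apply): `l2_split_bdd`, `transferApply_add_bdd`, `qform_comm_bdd` (Fubini + kernel symmetry),
  `qform_split_bdd` (combinations: `TwistedTraceScaling.Negative.R6.comb_measurable_bounded`);
* §2 ★ `exists_comb_qform_le_levelValue` — the max–min HALF of Courant–Fischer in family form, EXACT (no `e^{ελ_b}` slack; general `L`): for `β > 0` a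
  Gram-nondegenerate physical `(k+1)`-family has a NONZERO combination `ψ` with `⟨ψ,K_βψ⟩ ≤ λ_k(β,L)·‖ψ‖²` (dominating orthonormal eigenfamily
  `exists_isPhys_eigenfamily_dominating_of_pos` + rank–nullity `exists_ne_zero_forall_l2_eq_zero`); `exists_comb_qform_le_levelValue'` drops the Gram hypothesis
  (a null combination has `⟨ψ,Kψ⟩ = 0` by Cauchy–Schwarz, `VacDict.qform_self_le_levelValue_zero_mul`);
* §3 `feshbach_endgame` — the completed square: `Q_ψ = Q_φ + 2X + Q_χ`, `Q_χ ≤ θ n_χ`, `X² ≤ ρ n_φ n_χ`, `Q_φ ≤ D n_φ`, `θ < Λ`, `D + ρ/(Λ−θ) ≤ Λ ⟹ Q_ψ ≤ Λ(n_φ + n_χ)`;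
  `bo_numeric_endgame` — the whole rate bookkeeping in real numbers: almost-orthogonality, stiff gap, second-order cross term, diagonal vs the one-site form with
  dressing, one-site max–min and the floor with rate ⟹ `Q_ψ·μ₀ ≤ e^{(6C + C/gap)u²}·μ_k·λ₀·n_ψ`.
HONEST FRAMING: bookkeeping and the variational principle only; femto rung R2b1 (RECORD label) — not infinite volume, not a mass gap, not Clay.  No definitions, no
named facts, no `sorry`.
-/

set_option autoImplicit false

noncomputable section

open MeasureTheory Filter Topology Real
open scoped BigOperators
open Literature.MathematicalPhysics.QuantumFieldTheory hiding SU2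
open Literature.MathematicalPhysics.QuantumLattice

namespace Summit.QuantumFields.YangMills.Theorems.FemtoCutoffLadder

open Summit.QuantumFields.YangMills.Theorems.FemtoTransferGap

variable {L : ℕ} [NeZero L]

/-! ## §1 Bounded-measurable bookkeeping for an adiabatic split `ψ = φ + χ` -/

/-- The product of two bounded measurable functions of the links is integrable. [folklore] -/
theorem integrable_mul_bdd {f g : GaugeConfig 3 L SU2 → ℝ} (hf : Measurable f) {C : ℝ} (hC : ∀ U, |f U| ≤ C) (hg : Measurable g) {D : ℝ}
    (hD : ∀ U, |g U| ≤ D) : Integrable (fun U => f U * g U) (configMeasure SU2 L) := by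
  refine integrable_of_bounded_lat (hf.mul hg) (C := C * D) fun U => ?_
  rw [abs_mul]
  exact mul_le_mul (hC U) (hD U) (abs_nonneg _) ((abs_nonneg _).trans (hC U))

/-- `‖φ + χ‖² = ‖φ‖² + 2⟨φ,χ⟩ + ‖χ‖²` for bounded measurable `φ, χ`. [folklore] -/
theorem l2_split_bdd {ψ φ χ : GaugeConfig 3 L SU2 → ℝ} (hψ : ∀ U, ψ U = φ U + χ U) (hφ : Measurable φ) {C : ℝ} (hC : ∀ U, |φ U| ≤ C)
    (hχ : Measurable χ) {D : ℝ} (hD : ∀ U, |χ U| ≤ D) : l2 ψ ψ = l2 φ φ + 2 * l2 φ χ + l2 χ χ := by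
  unfold l2
  have h1 := integrable_mul_bdd hφ hC hφ hC
  have h2 := integrable_mul_bdd hφ hC hχ hD
  have h3 := integrable_mul_bdd hχ hD hχ hD
  have : (fun U => ψ U * ψ U) = fun U => (φ U * φ U + 2 * (φ U * χ U)) + χ U * χ U := by
    funext U; rw [hψ U]; ring
  rw [this, integral_add (f := fun U => φ U * φ U + 2 * (φ U * χ U)) (g := fun U => χ U * χ U) (h1.add (h2.const_mul 2)) h3,
    integral_add (f := fun U => φ U * φ U) (g := fun U => 2 * (φ U * χ U)) h1 (h2.const_mul 2), integral_const_mul]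

/-- `K_β(φ + χ) = K_βφ + K_βχ` pointwise for bounded measurable `φ, χ`. [folklore] -/
theorem transferApply_add_bdd (β : ℝ) {ψ φ χ : GaugeConfig 3 L SU2 → ℝ} (hψ : ∀ U, ψ U = φ U + χ U) (hφ : Measurable φ) {C : ℝ}
    (hC : ∀ U, |φ U| ≤ C) (hχ : Measurable χ) {D : ℝ} (hD : ∀ U, |χ U| ≤ D) (U : GaugeConfig 3 L SU2) :
    transferApply β ψ U = transferApply β φ U + transferApply β χ U := by
  simp only [transferApply_apply]
  rw [← integral_add (integrable_transferKernel_mul β U hφ hC) (integrable_transferKernel_mul β U hχ hD)]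
  refine integral_congr_ae (ae_of_all _ fun V => ?_)
  simp only [hψ V]; ring

/-- **The transfer form is symmetric on bounded measurable functions** (Fubini on the product space; symmetry of the kernel). [cite: SeilerLNP1982, §3] -/
theorem qform_comm_bdd {β : ℝ} {φ χ : GaugeConfig 3 L SU2 → ℝ} (hφ : Measurable φ) {C : ℝ} (hC : ∀ U, |φ U| ≤ C) (hχ : Measurable χ) {D : ℝ}
    (hD : ∀ U, |χ U| ≤ D) : qform su2Rep β φ χ = qform su2Rep β χ φ := by
  haveI : SecondCountableTopology SU2 := secondCountableTopology_su2
  obtain ⟨M, hM⟩ := exists_transferKernel_le su2Rep continuous_su2Rep β (L := L)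
  have hint : Integrable (Function.uncurry fun U V => φ U * transferKernel su2Rep β U V * χ V)
      ((configMeasure SU2 L).prod (configMeasure SU2 L)) := by
    refine Integrable.mono' (integrable_const (C * M * D))
      (((hφ.comp measurable_fst).mul (continuous_transferKernel su2Rep continuous_su2Rep β).measurable).mul
        (hχ.comp measurable_snd)).aestronglyMeasurable (ae_of_all _ fun p => ?_)
    obtain ⟨U, V⟩ := p
    have hK := transferKernel_pos su2Rep β U V
    simp only [Function.uncurry_apply_pair]
    rw [Real.norm_eq_abs, abs_mul, abs_mul, abs_of_pos hK]
    have h0 : 0 ≤ C := (abs_nonneg _).trans (hC U)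
    exact mul_le_mul (mul_le_mul (hC U) (hM U V) hK.le h0) (hD V) (abs_nonneg _) (mul_nonneg h0 (hK.le.trans (hM U V)))
  unfold qform
  rw [integral_integral_swap hint]
  refine integral_congr_ae (ae_of_all _ fun V => integral_congr_ae (ae_of_all _ fun U => ?_))
  show φ U * transferKernel su2Rep β U V * χ V = χ V * transferKernel su2Rep β V U * φ U
  rw [transferKernel_su2Rep_symm β U V]; ring

/-- `⟨φ + χ, K_β(φ + χ)⟩ = ⟨φ,Kφ⟩ + 2⟨φ,Kχ⟩ + ⟨χ,Kχ⟩` for bounded measurable `φ, χ`. [folklore] -/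
theorem qform_split_bdd (β : ℝ) {ψ φ χ : GaugeConfig 3 L SU2 → ℝ} (hψ : ∀ U, ψ U = φ U + χ U) (hφ : Measurable φ) {C : ℝ} (hC : ∀ U, |φ U| ≤ C)
    (hχ : Measurable χ) {D : ℝ} (hD : ∀ U, |χ U| ≤ D) :
    qform su2Rep β ψ ψ = qform su2Rep β φ φ + 2 * qform su2Rep β φ χ + qform su2Rep β χ χ := by
  obtain ⟨M, hM⟩ := exists_transferKernel_le su2Rep continuous_su2Rep β (L := L)
  have hTφm := measurable_transferApply β hφ (L := L)
  have hTχm := measurable_transferApply β hχ (L := L)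
  have hTφb := abs_transferApply_le β hM hφ hC
  have hTχb := abs_transferApply_le β hM hχ hD
  simp only [qform_eq_l2_transferApply]
  have hT : ∀ U, transferApply β ψ U = transferApply β φ U + transferApply β χ U := transferApply_add_bdd β hψ hφ hC hχ hD
  unfold l2
  have e1 : (fun U => ψ U * transferApply β ψ U) =
      fun U => (φ U * transferApply β φ U + φ U * transferApply β χ U) + (χ U * transferApply β φ U + χ U * transferApply β χ U) := by
    funext U; rw [hψ U, hT U]; ring
  rw [e1, integral_add (f := fun U => φ U * transferApply β φ U + φ U * transferApply β χ U)
      (g := fun U => χ U * transferApply β φ U + χ U * transferApply β χ U)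
      ((integrable_mul_bdd hφ hC hTφm hTφb).add (integrable_mul_bdd hφ hC hTχm hTχb))
      ((integrable_mul_bdd hχ hD hTφm hTφb).add (integrable_mul_bdd hχ hD hTχm hTχb)),
    integral_add (f := fun U => φ U * transferApply β φ U) (g := fun U => φ U * transferApply β χ U)
      (integrable_mul_bdd hφ hC hTφm hTφb) (integrable_mul_bdd hφ hC hTχm hTχb),
    integral_add (f := fun U => χ U * transferApply β φ U) (g := fun U => χ U * transferApply β χ U)
      (integrable_mul_bdd hχ hD hTφm hTφb) (integrable_mul_bdd hχ hD hTχm hTχb)]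
  have hsym : ∫ U, χ U * transferApply β φ U ∂configMeasure SU2 L = ∫ U, φ U * transferApply β χ U ∂configMeasure SU2 L := by
    have := qform_comm_bdd (β := β) hχ hD hφ hC
    simpa only [qform_eq_l2_transferApply, l2] using this
  rw [hsym]; ring

/-! ## §2 The max–min half of Courant–Fischer in family form (exact) -/

/-- ★ **Max–min, family form (exact)**: for `β > 0`, every physical `(k+1)`-family on `(ℤ/L)³` with nondegenerate Gram matrix has a NONZERO combination `ψ` with
`⟨ψ,K_βψ⟩ ≤ λ_k(β,L)·‖ψ‖²` — some nonzero element of the span is orthogonal to the first `k` members of a dominating orthonormal eigenfamily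
(`exists_isPhys_eigenfamily_dominating_of_pos`, rank–nullity `exists_ne_zero_forall_l2_eq_zero`). [cite: ReedSimonIV1978, Thm. XIII.1] -/
theorem exists_comb_qform_le_levelValue {β : ℝ} (hβ : 0 < β) {k : ℕ} (F : Fin (k + 1) → GaugeConfig 3 L SU2 → ℝ) (hF : ∀ i, IsPhys (F i))
    (hGram : ∀ a : Fin (k + 1) → ℝ, a ≠ 0 → 0 < l2 (fun U => ∑ i, a i * F i U) (fun U => ∑ i, a i * F i U)) :
    ∃ a : Fin (k + 1) → ℝ, a ≠ 0 ∧
      qform su2Rep β (fun U => ∑ i, a i * F i U) (fun U => ∑ i, a i * F i U) ≤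
        levelValue su2Rep L β k * l2 (fun U => ∑ i, a i * F i U) (fun U => ∑ i, a i * F i U) := by
  have hcomb : ∀ a : Fin (k + 1) → ℝ, (∑ i, a i • F i) = fun U => ∑ i, a i * F i U := fun a => by
    funext U; simp [Finset.sum_apply, smul_eq_mul]
  have hli : LinearIndependent ℝ F := by
    rw [Fintype.linearIndependent_iff]
    intro a ha
    by_contra hne
    push Not at hne
    have ha0 : a ≠ 0 := by
      obtain ⟨i, hi⟩ := hne
      intro h; exact hi (by simp [h])
    have hpos := hGram a ha0
    rw [← hcomb a, ha] at hpos
    simp [l2] at hpos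
  set W : Submodule ℝ (GaugeConfig 3 L SU2 → ℝ) := Submodule.span ℝ (Set.range F) with hW
  have hrank : Module.finrank ℝ W = k + 1 := by rw [hW, finrank_span_eq_card hli, Fintype.card_fin]
  have hmem : ∀ ψ ∈ W, ∃ a : Fin (k + 1) → ℝ, ψ = fun U => ∑ i, a i * F i U := fun ψ hψ => by
    obtain ⟨a, ha⟩ := (Submodule.mem_span_range_iff_exists_fun ℝ).mp hψ
    exact ⟨a, by rw [← ha, hcomb]⟩
  have hadm : ∀ ψ ∈ W, IsPhys ψ := fun ψ hψ => by
    obtain ⟨a, rfl⟩ := hmem ψ hψ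
    exact isPhys_sum_mul_lat Finset.univ F hF a
  obtain ⟨e, he, -, -, hdom⟩ := exists_isPhys_eigenfamily_dominating_of_pos (L := L) hβ k
  obtain ⟨ψ, hψW, hne, horth⟩ :=
    exists_ne_zero_forall_l2_eq_zero (lt_add_one k) W hrank hadm (fun i : Fin k => e (Fin.castSucc i)) fun i => he _
  obtain ⟨a, rfl⟩ := hmem ψ hψW
  refine ⟨a, fun h0 => hne ?_, hdom (Fin.last k) _ (hadm _ hψW) fun i hi => ?_⟩
  · funext U; simp [h0]
  · have hik : (i : ℕ) < k := by simpa [Fin.lt_def] using hi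
    have := horth ⟨i, hik⟩
    simpa [Fin.castSucc_mk] using this

/-- **Max–min in the form used by the door**: for `β > 0` and ANY physical `(k+1)`-family there is `a ≠ 0` with `⟨ψ_a,Kψ_a⟩ ≤ λ_k·‖ψ_a‖²` — if the Gram matrix
degenerates, a nonzero `a` with `‖ψ_a‖² = 0` does it (`VacDict.qform_self_le_levelValue_zero_mul`, `λ₀·0 = 0 ≤ λ_k·0`). [cite: ReedSimonIV1978, Thm. XIII.1] -/
theorem exists_comb_qform_le_levelValue' {β : ℝ} (hβ : 0 < β) {k : ℕ} (F : Fin (k + 1) → GaugeConfig 3 L SU2 → ℝ) (hF : ∀ i, IsPhys (F i)) :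
    ∃ a : Fin (k + 1) → ℝ, a ≠ 0 ∧
      qform su2Rep β (fun U => ∑ i, a i * F i U) (fun U => ∑ i, a i * F i U) ≤
        levelValue su2Rep L β k * l2 (fun U => ∑ i, a i * F i U) (fun U => ∑ i, a i * F i U) := by
  by_cases hGram : ∀ a : Fin (k + 1) → ℝ, a ≠ 0 → 0 < l2 (fun U => ∑ i, a i * F i U) (fun U => ∑ i, a i * F i U)
  · exact exists_comb_qform_le_levelValue hβ F hF hGram
  · push Not at hGram
    obtain ⟨a, ha, hle⟩ := hGram
    have hphys : IsPhys (fun U => ∑ i, a i * F i U) := isPhys_sum_mul_lat Finset.univ F hF a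
    have h0 : l2 (fun U => ∑ i, a i * F i U) (fun U => ∑ i, a i * F i U) = 0 := le_antisymm hle (l2_self_nonneg _)
    refine ⟨a, ha, ?_⟩
    have h1 := VacDict.qform_self_le_levelValue_zero_mul β hphys
    rw [h0, mul_zero] at h1 ⊢
    exact h1

/-! ## §3 The completed square (Feshbach–Schur endgame in real numbers) -/

/-- **Completed square.**  If `Q_ψ = Q_φ + 2X + Q_χ`, `Q_χ ≤ θ·n_χ`, `X² ≤ ρ·n_φ·n_χ` (`ρ, n_φ, n_χ ≥ 0`), `Q_φ ≤ D·n_φ`, `θ < Λ` and `D + ρ/(Λ−θ) ≤ Λ`, then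
`Q_ψ ≤ Λ·(n_φ + n_χ)`: `2X ≤ ρ n_φ/(Λ−θ) + (Λ−θ) n_χ`. [cite: GustafsonSigal2003, §11] -/
theorem feshbach_endgame {Qψ Qφ Qχ X nφ nχ θ ρ D Λ : ℝ} (hsplit : Qψ = Qφ + 2 * X + Qχ) (hnφ : 0 ≤ nφ) (hnχ : 0 ≤ nχ)
    (hθ : Qχ ≤ θ * nχ) (hρ : 0 ≤ ρ) (hX : X ^ 2 ≤ ρ * (nφ * nχ)) (hD : Qφ ≤ D * nφ) (ht : θ < Λ) (hbudget : D + ρ / (Λ - θ) ≤ Λ) :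
    Qψ ≤ Λ * (nφ + nχ) := by
  set t : ℝ := Λ - θ with htdef
  have ht0 : 0 < t := by rw [htdef]; linarith
  set u : ℝ := ρ * nφ / t with hu
  set v : ℝ := t * nχ with hv
  have hu0 : 0 ≤ u := by rw [hu]; positivity
  have hv0 : 0 ≤ v := by rw [hv]; positivity
  have huv : u * v = ρ * (nφ * nχ) := by rw [hu, hv]; field_simp
  have h2X : 2 * X ≤ u + v := by nlinarith [sq_nonneg (u - v), huv, hX, hu0, hv0, sq_nonneg (u + v - 2 * X), sq_nonneg (u + v + 2 * X)]
  have hD' : D ≤ Λ - ρ / t := by linarith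
  calc Qψ = Qφ + 2 * X + Qχ := hsplit
    _ ≤ D * nφ + (u + v) + θ * nχ := by linarith
    _ = (D + ρ / t) * nφ + (t + θ) * nχ := by rw [hu, hv]; ring
    _ ≤ Λ * nφ + Λ * nχ := by
        have h1 : (D + ρ / t) * nφ ≤ Λ * nφ := mul_le_mul_of_nonneg_right (by linarith) hnφ
        have h2 : (t + θ) * nχ = Λ * nχ := by rw [htdef]; ring
        linarith
    _ = Λ * (nφ + nχ) := by ring

/-- `e^{2x} + x ≤ e^{3x}` and `e^{a}(1 + y) ≤ e^{a + y}` bookkeeping: for `0 ≤ x`, `Real.exp (2 * x) + x ≤ Real.exp (3 * x)`. [folklore] -/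
theorem exp_two_mul_add_le {x : ℝ} (hx : 0 ≤ x) : Real.exp (2 * x) + x ≤ Real.exp (3 * x) := by
  have h1 : 1 ≤ Real.exp (2 * x) := Real.one_le_exp (by linarith)
  have h2 : x + 1 ≤ Real.exp x := Real.add_one_le_exp x
  have h3 : Real.exp (3 * x) = Real.exp (2 * x) * Real.exp x := by rw [← Real.exp_add]; ring_nf
  rw [h3]
  nlinarith [Real.exp_pos (2 * x), Real.exp_pos x]

/-- `a + b ≤ a·e^{b/a'}`-type step: for `0 ≤ y` and `0 < E`, `E + E * y ≤ E * Real.exp y`. [folklore] -/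
theorem mul_add_le_mul_exp {E y : ℝ} (hE : 0 ≤ E) (_hy : 0 ≤ y) : E + E * y ≤ E * Real.exp y := by
  have h := Real.add_one_le_exp y
  nlinarith
set_option maxHeartbeats 400000 in
/-- **The numeric Born–Oppenheimer endgame with rate** (all objects are real numbers; `x = C u²`): the split identities, (P1) almost-orthogonality, (P3) stiff
gap, (P4) cross term, (P5) diagonal, (P6) dressing, the one-site max–min `q_g ≤ μ_k n_g` and the floor `N μ₀ e^{−x} ≤ λ₀` give
`Q_ψ·μ₀ ≤ e^{(6C + C/gap)u²}·μ_k·λ₀·n_ψ`. [cite: GustafsonSigal2003, §11–§12] -/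
theorem bo_numeric_endgame {Qψ Qφ Qχ X nψ nφ nχ c qg ng N μ0 μk lam0 u C gap : ℝ}
    (hN : 0 < N) (hμ0 : 0 < μ0) (hμk : 0 < μk) (hgap : 0 < gap) (hC : 0 ≤ C) (hux : C * u ^ 2 ≤ 1 / 2)
    (hnφ : 0 ≤ nφ) (hnχ : 0 ≤ nχ) (hnψ : 0 ≤ nψ)
    (hsn : nψ = nφ + 2 * c + nχ) (hsQ : Qψ = Qφ + 2 * X + Qχ)
    (hP1 : 2 * |c| ≤ C * u ^ 2 * (nφ + nχ))
    (hP3 : Qχ ≤ (1 - gap) * (N * μk) * nχ)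
    (hP4 : X ^ 2 ≤ C * u ^ 2 * (N * μk) ^ 2 * (nφ * nχ))
    (hP5 : Qφ ≤ Real.exp (C * u ^ 2) * N * qg + C * u ^ 2 * (N * μk) * nφ)
    (hP6 : ng ≤ Real.exp (C * u ^ 2) * nφ)
    (hmm : qg ≤ μk * ng) (hfloor : N * μ0 * Real.exp (-(C * u ^ 2)) ≤ lam0) :
    Qψ * μ0 ≤ Real.exp ((6 * C + C / gap) * u ^ 2) * μk * lam0 * nψ := by
  -- abbreviations (plain `obtain`, no `set`)
  obtain ⟨x, hx⟩ : ∃ x : ℝ, x = C * u ^ 2 := ⟨_, rfl⟩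
  rw [← hx] at hux hP1 hP4 hP5 hP6 hfloor
  have hx0 : 0 ≤ x := by rw [hx]; positivity
  obtain ⟨M, hM⟩ : ∃ M : ℝ, M = N * μk := ⟨_, rfl⟩
  rw [← hM] at hP3 hP4 hP5
  have hM0 : 0 < M := by rw [hM]; exact mul_pos hN hμk
  -- the diagonal: `Q_φ ≤ M e^{3x} n_φ`
  have hqg' : qg ≤ μk * (Real.exp x * nφ) := hmm.trans (mul_le_mul_of_nonneg_left hP6 hμk.le)
  have hD : Qφ ≤ M * Real.exp (3 * x) * nφ := by
    have h1 : Real.exp x * N * qg ≤ Real.exp x * N * (μk * (Real.exp x * nφ)) :=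
      mul_le_mul_of_nonneg_left hqg' (by positivity)
    have h2 : Real.exp x * N * (μk * (Real.exp x * nφ)) = M * (Real.exp (2 * x) * nφ) := by
      rw [hM, show (2 : ℝ) * x = x + x by ring, Real.exp_add]; ring
    have h3 : Qφ ≤ M * ((Real.exp (2 * x) + x) * nφ) := by
      calc Qφ ≤ Real.exp x * N * qg + x * M * nφ := hP5
        _ ≤ M * (Real.exp (2 * x) * nφ) + x * M * nφ := by linarith
        _ = M * ((Real.exp (2 * x) + x) * nφ) := by ring
    calc Qφ ≤ M * ((Real.exp (2 * x) + x) * nφ) := h3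
      _ ≤ M * (Real.exp (3 * x) * nφ) :=
          mul_le_mul_of_nonneg_left (mul_le_mul_of_nonneg_right (exp_two_mul_add_le hx0) hnφ) hM0.le
      _ = M * Real.exp (3 * x) * nφ := by ring
  -- the completed square at `Λ₀ = M e^{3x + x/gap}`, `θ = (1 − gap) M`, `ρ = x M²`
  obtain ⟨Λ₀, hΛ₀⟩ : ∃ Λ₀ : ℝ, Λ₀ = M * Real.exp (3 * x + x / gap) := ⟨_, rfl⟩
  have hE1 : 1 ≤ Real.exp (3 * x + x / gap) := Real.one_le_exp (by positivity)
  have hΛ₀M : M ≤ Λ₀ := by rw [hΛ₀]; exact le_mul_of_one_le_right hM0.le hE1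
  have hgM : 0 < gap * M := mul_pos hgap hM0
  have ht : (1 - gap) * M < Λ₀ := by nlinarith
  have hgapM : gap * M ≤ Λ₀ - (1 - gap) * M := by nlinarith
  have hρ0 : 0 ≤ x * M ^ 2 := by positivity
  have hbudget : M * Real.exp (3 * x) + x * M ^ 2 / (Λ₀ - (1 - gap) * M) ≤ Λ₀ := by
    have h1 : x * M ^ 2 / (Λ₀ - (1 - gap) * M) ≤ x * M ^ 2 / (gap * M) := div_le_div_of_nonneg_left hρ0 hgM hgapM
    have h2 : x * M ^ 2 / (gap * M) = M * (x / gap) := by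
      field_simp
    have h5 := mul_add_le_mul_exp (E := M * Real.exp (3 * x)) (y := x / gap) (by positivity) (by positivity)
    have h4 : M * (x / gap) ≤ M * Real.exp (3 * x) * (x / gap) := by
      have : 1 * (x / gap) ≤ Real.exp (3 * x) * (x / gap) :=
        mul_le_mul_of_nonneg_right (Real.one_le_exp (by positivity)) (by positivity)
      nlinarith
    have h6 : M * Real.exp (3 * x) * Real.exp (x / gap) = Λ₀ := by rw [hΛ₀, Real.exp_add]; ring
    linarith
  have hX : X ^ 2 ≤ x * M ^ 2 * (nφ * nχ) := hP4
  have hfesh := feshbach_endgame (θ := (1 - gap) * M) (ρ := x * M ^ 2) (D := M * Real.exp (3 * x)) (Λ := Λ₀)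
    hsQ hnφ hnχ hP3 hρ0 hX hD ht hbudget
  -- almost-orthogonality: `n_φ + n_χ ≤ e^{2x} n_ψ`
  have hn : nφ + nχ ≤ Real.exp (2 * x) * nψ := by
    have hc : -(x * (nφ + nχ)) ≤ 2 * c := by
      have := neg_abs_le c
      linarith
    have h1 : (1 - x) * (nφ + nχ) ≤ nψ := by rw [hsn]; linarith
    have h2 : 1 ≤ (1 + 2 * x) * (1 - x) := by
      have : 0 ≤ x * (1 - 2 * x) := mul_nonneg hx0 (by linarith)
      nlinarith
    have hs0 : 0 ≤ nφ + nχ := add_nonneg hnφ hnχ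
    have h4 : nφ + nχ ≤ (1 + 2 * x) * ((1 - x) * (nφ + nχ)) := by
      have := mul_le_mul_of_nonneg_right h2 hs0
      linarith
    have h5 : (1 + 2 * x) * ((1 - x) * (nφ + nχ)) ≤ (1 + 2 * x) * nψ := mul_le_mul_of_nonneg_left h1 (by linarith)
    have h6 : (1 + 2 * x) * nψ ≤ Real.exp (2 * x) * nψ := by
      have := Real.add_one_le_exp (2 * x)
      exact mul_le_mul_of_nonneg_right (by linarith) hnψ
    linarith
  have hΛ₀0 : 0 ≤ Λ₀ := hM0.le.trans hΛ₀M
  have hQψ : Qψ ≤ Λ₀ * (Real.exp (2 * x) * nψ) := hfesh.trans (mul_le_mul_of_nonneg_left hn hΛ₀0)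
  -- the floor: `N μ₀ ≤ λ₀ e^{x}`
  have hfl : N * μ0 ≤ lam0 * Real.exp x := by
    have h1 : N * μ0 * Real.exp (-x) * Real.exp x = N * μ0 := by
      rw [mul_assoc, ← Real.exp_add]; simp
    have h2 := mul_le_mul_of_nonneg_right hfloor (Real.exp_pos x).le
    linarith
  -- assemble: `Q_ψ μ₀ ≤ (N μ₀)·(μ_k e^{3x+x/gap} e^{2x} n_ψ) ≤ (λ₀ eˣ)·(…)`
  have hT0 : 0 ≤ μk * Real.exp (3 * x + x / gap) * (Real.exp (2 * x) * nψ) := by positivity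
  have step1 : Qψ * μ0 ≤ (N * μ0) * (μk * Real.exp (3 * x + x / gap) * (Real.exp (2 * x) * nψ)) := by
    have h1 := mul_le_mul_of_nonneg_right hQψ hμ0.le
    have h2 : Λ₀ * (Real.exp (2 * x) * nψ) * μ0 = (N * μ0) * (μk * Real.exp (3 * x + x / gap) * (Real.exp (2 * x) * nψ)) := by
      rw [hΛ₀, hM]; ring
    linarith
  have step2 : (N * μ0) * (μk * Real.exp (3 * x + x / gap) * (Real.exp (2 * x) * nψ)) ≤
      (lam0 * Real.exp x) * (μk * Real.exp (3 * x + x / gap) * (Real.exp (2 * x) * nψ)) :=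
    mul_le_mul_of_nonneg_right hfl hT0
  have step3 : (lam0 * Real.exp x) * (μk * Real.exp (3 * x + x / gap) * (Real.exp (2 * x) * nψ)) =
      Real.exp ((6 * C + C / gap) * u ^ 2) * μk * lam0 * nψ := by
    have hexp : Real.exp ((6 * C + C / gap) * u ^ 2) = Real.exp x * Real.exp (3 * x + x / gap) * Real.exp (2 * x) := by
      rw [← Real.exp_add, ← Real.exp_add]; congr 1; rw [hx]; ring
    rw [hexp]; ring
  linarith

end Summit.QuantumFields.YangMills.Theorems.FemtoCutoffLadder

end
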